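/-
COR-CM (cell pub-hodgecm2, stage 2 of the Hodge ladder) — junction B01 `PerLFace_of_PerL`: the last arrow of the INDEPENDENCE
TABLE of `CorCM/FaceInputsIndependence.lean` — B01-O `Universe.FaceWedgeOverlap` (`CorCM/B01/FaceInputsSplit.lean`) is implied
neither by `PeriodThmF` nor by B01-C `Universe.FaceSeesawCoupling`, uniformly in the universe.  Seat prover-pub-hodgecm2-b07
(gen 30), 2026-08-21; count-neutral calibration (no binder row; nothing under `CorCM/B01/` edited).  Two SUPPORT definitions
(`Universe.twistPull`, `Universe.twistShadow`: a variant of b14's `Universe.perLShadow`; not Prop-valued, displayed nowhere)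
and theorems; nothing cited, nothing asserted.
-/
import Summits.HodgeConjecture.CorCM.FaceInputsIndependence
import HarnessLib

/-!
# B01-O is a genuine strengthening of `PerLFace` and of B01-C: the twisted shadow

`FaceInputsIndependence.lean` left one arrow open: is `PeriodThmF → FaceWedgeOverlap` universe-uniform?  On a TYPE-UNIFORM
shadow (`U_Ψ(Γ)` the same subspace for all `Ψ ∋ σ`) B01-O holds as soon as a non-zero (12)-wedge exists (that wedge is
itself a (34)-wedge); in the model universe `U_Ψ(Γ)` depends on `Ψ` through `Mor(P_Γ, A_{(K,Ψ)})`, and so it does on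
THE TWISTED SHADOW `U.twistShadow s` (`s : U.Var → ℚ`): b14's PerL shadow with every Picard modular surface the synthetic
surface `inr true` (`H^k = ℚ × ℚ`, cup componentwise, trace = first coordinate, self-maps = identity) and a "morphism"
`g : H¹(Y) → ℚ × ℚ` to a variety `Y` of `U` pulling back in degree one by `y ↦ (g y).1 • (1, s Y)` (`Universe.twistPull`), so
that `U_Ψ(Γ) = ℂ · (1 ⊗ (1, s(A_{(K,Ψ)})))` (`twistShadow_exists_of_mem_Uiso`, `twistShadow_tmul_mem_Uiso`; M13 + M14 on `U`).
* For every `s`: `PeriodThmF`, `FaceLineField`, `FaceSupply`, `FaceSeesawCoupling` HOLD (`twistShadow_periodThmF`, …): the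
  period of supplied classes `cᵢ ⊗ (1, aᵢ)` is `c₀ c₁ conj(c₂) conj(c₃)` whatever the `aᵢ` (`twistShadow_period_tmul_one`).
* For `s = 1` on `{A_{Ψ₀}, A_{Ψ₁}}`, `s = 0` on `{A_{Ψ₂}, A_{Ψ₃}}` of ONE face: `FaceWedgeOverlap` FAILS
  (`twistShadow_not_faceWedgeOverlap`): the non-zero (12)-wedge `1 ⊗ (1,1)` has only itself as a translate, the (34)-wedges
  are multiples of `1 ⊗ (1,0)`.

CONSEQUENCES (relative to M13 + M14 + injectivity of `Ψ ↦ U.cmAV K Ψ`; unconditional through `cmTypeUniverse`,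
`Model.cmCode_injective`): `not_forall_periodThmF_imp_faceWedgeOverlap : ¬ ∀ U, U.PeriodThmF → U.FaceWedgeOverlap` (B01-O,
like B01-C, is a GENUINE strengthening of `PerLFace`; B01-L/B01-S are not) and `not_forall_faceSeesawCoupling_imp_faceWedgeOverlap :
¬ ∀ U, U.PeriodThmF → U.FaceSeesawCoupling → U.FaceWedgeOverlap` (over abstract universes the v3.22 leaf B01-O is strictly
stronger than the v3.21 leaf B01-C it replaced; the converse O → C holds with the cone facts and Hodge–Riemann (2,0),
`faceSeesawCoupling_of_wedgeOverlap` / `Model.universeOf_faceSeesawCoupling_of_wedgeOverlap`, and fails without them,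
`not_forall_supply_wedgeOverlap_imp_faceSeesawCoupling`).  Nothing is said about the model universe of record or about B01-H.
-/

noncomputable section

open scoped TensorProduct
open NumberField

namespace Summit.HodgeConjecture.CorCM

open Literature.AlgebraicGeometry.Motives (CMType HodgeStructure)
open Literature.AlgebraicGeometry.Motives.HodgeStructure (conj)
open Literature.NumberTheory.Automorphic
open Literature.NumberTheory.Automorphic.PicardCM
open Literature.NumberTheory.ComplexMultiplication (CMTypeOps.flip CMTypeOps.placeSet CMTypeOps.flip_flip)

/-! ### Linear algebra: base change of `φ.smulRight v`, products on the synthetic plane -/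

/-- `(φ · v)_ℂ (x) = φ_ℂ(x) ⊗ v` for a rational linear form `φ` and a vector `v`. [folklore] -/
theorem baseChange_smulRight_apply {M N : Type*} [AddCommGroup M] [Module ℚ M] [AddCommGroup N] [Module ℚ N]
    (φ : M →ₗ[ℚ] ℚ) (v : N) (x : ℂ ⊗[ℚ] M) :
    (φ.smulRight v).baseChange ℂ x = (TensorProduct.AlgebraTensorModule.rid ℚ ℂ ℂ (φ.baseChange ℂ x)) ⊗ₜ[ℚ] v := by
  induction x using TensorProduct.induction_on with
  | zero => rw [map_zero, map_zero, map_zero, TensorProduct.zero_tmul]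
  | tmul a m =>
      rw [LinearMap.baseChange_tmul, LinearMap.baseChange_tmul, LinearMap.smulRight_apply, TensorProduct.tmul_smul,
        TensorProduct.smul_tmul', TensorProduct.AlgebraTensorModule.rid_tmul]
  | add x y hx hy => rw [map_add, map_add, map_add, hx, hy, TensorProduct.add_tmul]

/-- On the synthetic plane: `(a ⊗ (1,p)) ∪ (b ⊗ (1,q)) = ab ⊗ (1,pq)`. [folklore] -/
theorem mulC_tmul_one (a b : ℂ) (p q : ℚ) :
    LinearMap.BilinMap.baseChange ℂ (LinearMap.mul ℚ (ℚ × ℚ)) (a ⊗ₜ[ℚ] ((1, p) : ℚ × ℚ)) (b ⊗ₜ[ℚ] ((1, q) : ℚ × ℚ)) =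
      (a * b) ⊗ₜ[ℚ] ((1, p * q) : ℚ × ℚ) := by
  rw [LinearMap.BilinMap.baseChange_tmul, LinearMap.mul_apply', Prod.mk_mul_mk, mul_one]

/-- Reading the second coordinate: `c ⊗ (p,q) ↦ q • c`. [folklore] -/
theorem rid_snd_baseChange_tmul (c : ℂ) (p q : ℚ) :
    TensorProduct.AlgebraTensorModule.rid ℚ ℂ ℂ ((LinearMap.snd ℚ ℚ ℚ).baseChange ℂ (c ⊗ₜ[ℚ] ((p, q) : ℚ × ℚ))) =
      q • c := by
  rw [LinearMap.baseChange_tmul, LinearMap.snd_apply, TensorProduct.AlgebraTensorModule.rid_tmul]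

/-- A class `c ⊗ (p,q)` with `c ≠ 0`, `q ≠ 0` is non-zero (read its second coordinate). [folklore] -/
theorem tmul_ne_zero_of_ne_zero {c : ℂ} (hc : c ≠ 0) {p q : ℚ} (hq : q ≠ 0) : c ⊗ₜ[ℚ] ((p, q) : ℚ × ℚ) ≠ 0 := by
  intro h
  have h' := congrArg
    (fun z => TensorProduct.AlgebraTensorModule.rid ℚ ℂ ℂ ((LinearMap.snd ℚ ℚ ℚ).baseChange ℂ z)) h
  simp only [rid_snd_baseChange_tmul, map_zero] at h'
  exact smul_ne_zero hq hc h'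

/-- `Φ^{(p)} ≠ Φ`: flipping a CM type at a place changes it (`{p, p̄} ≠ ∅`). [folklore] -/
theorem flip_ne_self {K : Type} [Field K] (p : K →+* ℂ) (Φ : CMType K) : CMTypeOps.flip p Φ ≠ Φ := by
  intro h
  have h1 : symmDiff Φ.1 (CMTypeOps.placeSet p) = Φ.1 := congrArg Subtype.val h
  have h2 : p ∈ CMTypeOps.placeSet p := Set.mem_insert _ _
  rw [symmDiff_eq_left.1 h1, Set.bot_eq_empty] at h2
  exact Set.notMem_empty p h2

/-- The period types of slots `2, 3` of a face differ from those of slots `0, 1`. [folklore] -/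
theorem Face.psi_ne {K : Type} [Field K] (f : Face K) :
    f.psi 2 ≠ f.psi 0 ∧ f.psi 2 ≠ f.psi 1 ∧ f.psi 3 ≠ f.psi 0 ∧ f.psi 3 ≠ f.psi 1 := by
  refine ⟨?_, ?_, ?_, ?_⟩
  · show CMTypeOps.flip f.p f.Φ ≠ f.Φ
    exact flip_ne_self f.p f.Φ
  · show CMTypeOps.flip f.p f.Φ ≠ CMTypeOps.flip f.p' (CMTypeOps.flip f.p f.Φ)
    exact fun h => flip_ne_self f.p' _ h.symm
  · show CMTypeOps.flip f.p' f.Φ ≠ f.Φ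
    exact flip_ne_self f.p' f.Φ
  · show CMTypeOps.flip f.p' f.Φ ≠ CMTypeOps.flip f.p' (CMTypeOps.flip f.p f.Φ)
    intro h
    have h' := congrArg (CMTypeOps.flip f.p') h
    rw [CMTypeOps.flip_flip, CMTypeOps.flip_flip] at h'
    exact flip_ne_self f.p f.Φ h'.symm

namespace Universe

variable (U : Universe)

/-- **Twisted pull-backs** for the carriers and "morphisms" of b14's PerL shadow: as `Universe.shadowPull`, except that a
"morphism" `g : H¹(Y, ℚ) → ℚ × ℚ` from the synthetic surface `inr true` to a variety `Y` of `U` pulls back, in degree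
one, by `y ↦ (g y).1 • (1, s Y)` — a direction depending on the TARGET variety. -/
def twistPull (s : U.Var → ℚ) :
    ∀ {X Y : U.Var ⊕ Bool}, U.shadowMor X Y → ∀ k : ℕ, U.shadowCoh Y k →ₗ[ℚ] U.shadowCoh X k
  | .inl _, .inl _, f, k => U.pull f k
  | .inr true, .inl Y, f, 1 => (LinearMap.fst ℚ ℚ ℚ ∘ₗ f).smulRight (((1 : ℚ), s Y) : ℚ × ℚ)
  | .inr true, .inl _, _, 0 => 0
  | .inr true, .inl _, _, (_ + 2) => 0
  | .inr false, .inl _, _, _ => 0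
  | .inl _, .inr _, f, _ => PEmpty.elim f
  | .inr _, .inr _, _, _ => LinearMap.id

/-- **The twisted shadow of `U`** (twist `s : U.Var → ℚ`): b14's `U.perLShadow` with EVERY Picard modular surface the
synthetic surface `inr true` and with the twisted pull-backs `U.twistPull s`.  A separating structure for the
Prop-valued definitions `PeriodThmF`, `FaceSeesawCoupling`, `FaceWedgeOverlap`; nothing is claimed about the model facts. -/
def twistShadow (s : U.Var → ℚ) : Universe :=
  { U.perLShadow with
    pms := fun _ _ _ _ => Sum.inr true
    pull := fun f k => U.twistPull s f k }

/-- **The period of four classes `ωᵢ = cᵢ ⊗ (1, aᵢ)` on a surface of the twisted shadow is `c₀ c₁ conj(c₂) conj(c₃)`**,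
whatever the second coordinates `aᵢ` (the trace reads the first coordinate). [folklore] -/
theorem twistShadow_period_tmul_one (s : U.Var → ℚ) {L : CMField} {ι₁ : L →+* ℂ} {V : HermSpace3 L ι₁} (Γ : Level V)
    (ω : Fin 4 → (U.twistShadow s).CohC ((U.twistShadow s).pms L ι₁ V Γ) 1) (c : Fin 4 → ℂ) (a : Fin 4 → ℚ)
    (h : ∀ i, ω i = c i ⊗ₜ[ℚ] (((1 : ℚ), a i) : ℚ × ℚ)) :
    (U.twistShadow s).period ((U.twistShadow s).pms L ι₁ V Γ) ω =
      c 0 * c 1 * (starRingEnd ℂ (c 2) * starRingEnd ℂ (c 3)) := by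
  show TensorProduct.AlgebraTensorModule.rid ℚ ℂ ℂ ((LinearMap.fst ℚ ℚ ℚ).baseChange ℂ
      (LinearMap.BilinMap.baseChange ℂ (LinearMap.mul ℚ (ℚ × ℚ))
        (LinearMap.BilinMap.baseChange ℂ (LinearMap.mul ℚ (ℚ × ℚ)) (ω 0) (ω 1))
        (LinearMap.BilinMap.baseChange ℂ (LinearMap.mul ℚ (ℚ × ℚ)) (conj (ω 2)) (conj (ω 3))))) = _
  rw [h 0, h 1, h 2, h 3]
  simp only [HodgeStructure.conj_tmul, LinearMap.BilinMap.baseChange_tmul, LinearMap.mul_apply',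
    Prod.mk_mul_mk, mul_one, LinearMap.baseChange_tmul, LinearMap.fst_apply,
    TensorProduct.AlgebraTensorModule.rid_tmul, one_smul]

/-- On a surface of the twisted shadow: if every generator of a span is a multiple of `1 ⊗ w`, so is every element.
[folklore] -/
theorem twistShadow_exists_eq_tmul_of_mem_span (s : U.Var → ℚ) {L : CMField} {ι₁ : L →+* ℂ} {V : HermSpace3 L ι₁}
    (Γ : Level V) (k : ℕ) (w : ℚ × ℚ) {S : Set ((U.twistShadow s).CohC ((U.twistShadow s).pms L ι₁ V Γ) k)}
    (hS : ∀ y ∈ S, ∃ c : ℂ, y = c ⊗ₜ[ℚ] w) {x : (U.twistShadow s).CohC ((U.twistShadow s).pms L ι₁ V Γ) k}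
    (hx : x ∈ Submodule.span ℂ S) : ∃ c : ℂ, x = c ⊗ₜ[ℚ] w := by
  induction hx using Submodule.span_induction with
  | mem y hy => exact hS y hy
  | zero => exact ⟨0, (TensorProduct.zero_tmul _ _).symm⟩
  | add y z _ _ hy hz =>
      obtain ⟨c, rfl⟩ := hy
      obtain ⟨d, rfl⟩ := hz
      exact ⟨c + d, (TensorProduct.add_tmul c d _).symm⟩
  | smul r y _ hy =>
      obtain ⟨c, rfl⟩ := hy
      refine ⟨r * c, ?_⟩
      rw [show (r * c) ⊗ₜ[ℚ] w = r • (c ⊗ₜ[ℚ] w) from by rw [TensorProduct.smul_tmul', smul_eq_mul]]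
      rfl

/-- **Every class of `U_Ψ(Γ)` on the twisted shadow is a multiple of `1 ⊗ (1, s(A_{(K,Ψ)}))`.** [folklore] -/
theorem twistShadow_exists_of_mem_Uiso (s : U.Var → ℚ) {L : CMField} {ι₁ : L →+* ℂ} {V : HermSpace3 L ι₁}
    {Γ : Level V} {K : CMField} {Ψ : CMType K} {σ : K →+* ℂ}
    {x : (U.twistShadow s).CohC ((U.twistShadow s).pms L ι₁ V Γ) 1} (hx : x ∈ (U.twistShadow s).Uiso Γ K Ψ σ) :
    ∃ c : ℂ, x = c ⊗ₜ[ℚ] (((1 : ℚ), s (U.cmAV K Ψ)) : ℚ × ℚ) :=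
  U.twistShadow_exists_eq_tmul_of_mem_span s Γ 1 _ (fun y hy => by
    obtain ⟨F, α, -, rfl⟩ := hy
    exact ⟨_, baseChange_smulRight_apply (LinearMap.fst ℚ ℚ ℚ ∘ₗ F) _ α⟩) hx

/-- A "morphism" `inl ∘ g` out of the synthetic surface pulls `α` back to `c ⊗ (1, s Y)`, where `g_ℂ(α) = c ⊗ 1`.
[folklore] -/
theorem twistShadow_pullC_inl_comp (s : U.Var → ℚ) {L : CMField} {ι₁ : L →+* ℂ} {V : HermSpace3 L ι₁} (Γ : Level V)
    {Y : U.Var} (g : U.Coh Y 1 →ₗ[ℚ] ℚ) {α : U.CohC Y 1} {c : ℂ} (hg : g.baseChange ℂ α = c ⊗ₜ[ℚ] (1 : ℚ)) :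
    (U.twistShadow s).pullC (X := (U.twistShadow s).pms L ι₁ V Γ) (Y := Sum.inl Y)
        (LinearMap.inl ℚ ℚ ℚ ∘ₗ g : U.Coh Y 1 →ₗ[ℚ] ℚ × ℚ) 1 α = c ⊗ₜ[ℚ] (((1 : ℚ), s Y) : ℚ × ℚ) := by
  show ((LinearMap.fst ℚ ℚ ℚ ∘ₗ (LinearMap.inl ℚ ℚ ℚ ∘ₗ g)).smulRight (((1 : ℚ), s Y) : ℚ × ℚ)).baseChange ℂ α = _
  rw [← LinearMap.comp_assoc, LinearMap.fst_comp_inl, LinearMap.id_comp, baseChange_smulRight_apply, hg,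
    TensorProduct.AlgebraTensorModule.rid_tmul, one_smul]

/-- **Every multiple of `1 ⊗ (1, s(A_{(K,Ψ)}))` lies in `U_Ψ(Γ)`** on the twisted shadow, for `σ ∈ Ψ` (given M13 + M14
on `U`): pull the non-zero `σ`-eigen one-form `α` back along the "morphism" `inl ∘ g` of `exists_alphaLine_dual`. [folklore] -/
theorem twistShadow_tmul_mem_Uiso (hE : U.Fact_eigenLine) (hA : U.Fact_alphaLine) (s : U.Var → ℚ) {L : CMField}
    {ι₁ : L →+* ℂ} {V : HermSpace3 L ι₁} (Γ : Level V) (K : CMField) (Ψ : CMType K) {σ : K →+* ℂ} (hσ : σ ∈ Ψ.1)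
    (c : ℂ) : c ⊗ₜ[ℚ] (((1 : ℚ), s (U.cmAV K Ψ)) : ℚ × ℚ) ∈ (U.twistShadow s).Uiso Γ K Ψ σ := by
  obtain ⟨α, hα, g, c₀, hc₀, hg⟩ := U.exists_alphaLine_dual hE hA K Ψ hσ
  have hmem : c₀ ⊗ₜ[ℚ] (((1 : ℚ), s (U.cmAV K Ψ)) : ℚ × ℚ) ∈ (U.twistShadow s).Uiso Γ K Ψ σ :=
    Submodule.subset_span ⟨(LinearMap.inl ℚ ℚ ℚ ∘ₗ g : U.Coh (U.cmAV K Ψ) 1 →ₗ[ℚ] ℚ × ℚ), α, hα,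
      (U.twistShadow_pullC_inl_comp s Γ g hg).symm⟩
  have hsmul : c ⊗ₜ[ℚ] (((1 : ℚ), s (U.cmAV K Ψ)) : ℚ × ℚ) =
      (c / c₀) • (c₀ ⊗ₜ[ℚ] (((1 : ℚ), s (U.cmAV K Ψ)) : ℚ × ℚ)) := by
    rw [TensorProduct.smul_tmul', smul_eq_mul, div_mul_cancel₀ c hc₀]
  rw [hsmul]
  exact Submodule.smul_mem _ _ hmem

/-- Every "morphism" `P_{Γ'} → P_Γ` of the twisted shadow (there is exactly one, the identity of the synthetic surface)
pulls back by the identity. [folklore] -/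
theorem twistShadow_pullC_pms (s : U.Var → ℚ) {L : CMField} {ι₁ : L →+* ℂ} {V : HermSpace3 L ι₁} (Γ' Γ : Level V)
    (g : (U.twistShadow s).Mor ((U.twistShadow s).pms L ι₁ V Γ') ((U.twistShadow s).pms L ι₁ V Γ)) (k : ℕ)
    (y : (U.twistShadow s).CohC ((U.twistShadow s).pms L ι₁ V Γ) k) : (U.twistShadow s).pullC g k y = y := by
  show ((LinearMap.id : (ℚ × ℚ) →ₗ[ℚ] ℚ × ℚ).baseChange ℂ) y = y
  rw [LinearMap.baseChange_id, LinearMap.id_apply]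

/-- **`PeriodThmF` HOLDS on the twisted shadow**, for every twist (given M13 + M14 on `U`): at any face datum the classes
`cᵢ ⊗ (1, s(A_{Ψᵢ}))`, `cᵢ ≠ 0`, are pulled-back eigen-forms and their period is `c₀ c₁ conj(c₂) conj(c₃) ≠ 0`. [folklore] -/
theorem twistShadow_periodThmF (hE : U.Fact_eigenLine) (hA : U.Fact_alphaLine) (s : U.Var → ℚ) :
    (U.twistShadow s).PeriodThmF := by
  intro F _ _ f ι₁ hf V
  obtain ⟨Γ⟩ := Level.nonempty V
  have hψ := admissible_mem_psi f ι₁ hf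
  have hw : ∀ i : Fin 4,
      ∃ (Fm : (U.twistShadow s).Mor ((U.twistShadow s).pms F ι₁ V Γ) ((U.twistShadow s).cmAV F (f.psi i)))
        (α : (U.twistShadow s).CohC ((U.twistShadow s).cmAV F (f.psi i)) 1) (c : ℂ),
        α ∈ (U.twistShadow s).alphaLine F (f.psi i) ι₁ ∧ c ≠ 0 ∧
          (U.twistShadow s).pullC Fm 1 α = c ⊗ₜ[ℚ] (((1 : ℚ), s (U.cmAV F (f.psi i))) : ℚ × ℚ) := fun i => by
    obtain ⟨α, hα, g, c₀, hc₀, hg⟩ := U.exists_alphaLine_dual hE hA F (f.psi i) (hψ i)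
    exact ⟨(LinearMap.inl ℚ ℚ ℚ ∘ₗ g : U.Coh (U.cmAV F (f.psi i)) 1 →ₗ[ℚ] ℚ × ℚ), α, c₀, hα, hc₀,
      U.twistShadow_pullC_inl_comp s Γ g hg⟩
  choose Fm α c hα hc hFm using hw
  refine ⟨Γ, Fm, α, hα, ?_⟩
  rw [U.twistShadow_period_tmul_one s Γ _ c (fun i => s (U.cmAV F (f.psi i))) hFm]
  exact mul_ne_zero (mul_ne_zero (hc 0) (hc 1))
    (mul_ne_zero ((map_ne_zero _).2 (hc 2)) ((map_ne_zero _).2 (hc 3)))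

/-- **B01-C `FaceSeesawCoupling` HOLDS on the twisted shadow**, for every twist (given M13 + M14 on `U`): a non-zero
(12)-wedge `(a ⊗ w₀) ∪ (b ⊗ w₁)` has `ab ≠ 0`; with `ω₂ = 1 ⊗ w₂`, `ω₃ = 1 ⊗ w₃`, `g = id` the period is `ab`. [folklore] -/
theorem twistShadow_faceSeesawCoupling (hE : U.Fact_eigenLine) (hA : U.Fact_alphaLine) (s : U.Var → ℚ) :
    (U.twistShadow s).FaceSeesawCoupling := by
  intro F _ _ f ι₁ hf V Γ ω₀ ω₁ h₀ h₁ hne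
  have hψ := admissible_mem_psi f ι₁ hf
  obtain ⟨a, rfl⟩ := U.twistShadow_exists_of_mem_Uiso s h₀
  obtain ⟨b, rfl⟩ := U.twistShadow_exists_of_mem_Uiso s h₁
  have hab : a * b ≠ 0 := by
    intro h0
    apply hne
    show LinearMap.BilinMap.baseChange ℂ (LinearMap.mul ℚ (ℚ × ℚ)) (a ⊗ₜ[ℚ] (((1 : ℚ), s (U.cmAV F (f.psi 0))) : ℚ × ℚ))
      (b ⊗ₜ[ℚ] (((1 : ℚ), s (U.cmAV F (f.psi 1))) : ℚ × ℚ)) = 0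
    rw [mulC_tmul_one, h0, TensorProduct.zero_tmul]
  refine ⟨Γ, (U.twistShadow s).idMor _, (1 : ℂ) ⊗ₜ[ℚ] (((1 : ℚ), s (U.cmAV F (f.psi 2))) : ℚ × ℚ),
    (1 : ℂ) ⊗ₜ[ℚ] (((1 : ℚ), s (U.cmAV F (f.psi 3))) : ℚ × ℚ),
    U.twistShadow_tmul_mem_Uiso hE hA s Γ F (f.psi 2) (hψ 2) 1,
    U.twistShadow_tmul_mem_Uiso hE hA s Γ F (f.psi 3) (hψ 3) 1, ?_⟩
  rw [U.twistShadow_period_tmul_one s Γ _ ![a, b, 1, 1]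
    ![s (U.cmAV F (f.psi 0)), s (U.cmAV F (f.psi 1)), s (U.cmAV F (f.psi 2)), s (U.cmAV F (f.psi 3))] ?_]
  · show a * b * (starRingEnd ℂ 1 * starRingEnd ℂ 1) ≠ 0
    rw [map_one, mul_one, mul_one]
    exact hab
  · intro i
    fin_cases i
    · exact U.twistShadow_pullC_pms s Γ Γ _ 1 _
    · exact U.twistShadow_pullC_pms s Γ Γ _ 1 _
    · rfl
    · rfl

/-- B01-L HOLDS on the twisted shadow (given M13 + M14 on `U`). [folklore] -/
theorem twistShadow_faceLineField (hE : U.Fact_eigenLine) (hA : U.Fact_alphaLine) (s : U.Var → ℚ) :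
    (U.twistShadow s).FaceLineField :=
  Universe.faceLineField_of_periodThmF _ (U.twistShadow_periodThmF hE hA s)

/-- B01-S HOLDS on the twisted shadow (given M13 + M14 on `U`). [folklore] -/
theorem twistShadow_faceSupply (hE : U.Fact_eigenLine) (hA : U.Fact_alphaLine) (s : U.Var → ℚ) :
    (U.twistShadow s).FaceSupply :=
  Universe.faceSupply_of_faceLineField _ (U.twistShadow_faceLineField hE hA s)

/-- **B01-O `FaceWedgeOverlap` FAILS on the twisted shadow** whose twist is `1` on `A_{Ψ₀}`, `A_{Ψ₁}` and `0` on `A_{Ψ₂}`,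
`A_{Ψ₃}` for some face datum (given M13 + M14 on `U`): the (12)-wedge `1 ⊗ (1,1) ≠ 0` has only itself as a translate, the
(34)-wedges are multiples of `1 ⊗ (1,0)`, and the two lines meet in `0` (read the second coordinate). [folklore] -/
theorem twistShadow_not_faceWedgeOverlap (hE : U.Fact_eigenLine) (hA : U.Fact_alphaLine) (s : U.Var → ℚ)
    {F₀ : CMField} (hG : IsGalois ℚ F₀) (h6 : 6 ≤ Module.finrank ℚ F₀) (f₀ : Face F₀) {ι₁ : F₀ →+* ℂ}
    (hf : f₀.Admissible ι₁) (V : HermSpace3 F₀ ι₁)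
    (hs0 : s (U.cmAV F₀ (f₀.psi 0)) = 1) (hs1 : s (U.cmAV F₀ (f₀.psi 1)) = 1)
    (hs2 : s (U.cmAV F₀ (f₀.psi 2)) = 0) (hs3 : s (U.cmAV F₀ (f₀.psi 3)) = 0) :
    ¬ (U.twistShadow s).FaceWedgeOverlap := by
  intro h
  obtain ⟨Γ⟩ := Level.nonempty V
  have hψ := admissible_mem_psi f₀ ι₁ hf
  have h₀ := U.twistShadow_tmul_mem_Uiso hE hA s Γ F₀ (f₀.psi 0) (hψ 0) 1
  have h₁ := U.twistShadow_tmul_mem_Uiso hE hA s Γ F₀ (f₀.psi 1) (hψ 1) 1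
  rw [hs0] at h₀
  rw [hs1] at h₁
  -- the (12)-wedge
  have hw : (U.twistShadow s).cup2C ((U.twistShadow s).pms F₀ ι₁ V Γ) 1
      ((1 : ℂ) ⊗ₜ[ℚ] (((1 : ℚ), (1 : ℚ)) : ℚ × ℚ)) ((1 : ℂ) ⊗ₜ[ℚ] (((1 : ℚ), (1 : ℚ)) : ℚ × ℚ)) =
        (1 : ℂ) ⊗ₜ[ℚ] (((1 : ℚ), (1 : ℚ)) : ℚ × ℚ) := by
    show LinearMap.BilinMap.baseChange ℂ (LinearMap.mul ℚ (ℚ × ℚ)) ((1 : ℂ) ⊗ₜ[ℚ] (((1 : ℚ), (1 : ℚ)) : ℚ × ℚ))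
      ((1 : ℂ) ⊗ₜ[ℚ] (((1 : ℚ), (1 : ℚ)) : ℚ × ℚ)) = (1 : ℂ) ⊗ₜ[ℚ] (((1 : ℚ), (1 : ℚ)) : ℚ × ℚ)
    rw [mulC_tmul_one, mul_one, mul_one]
  have hne : (U.twistShadow s).cup2C ((U.twistShadow s).pms F₀ ι₁ V Γ) 1
      ((1 : ℂ) ⊗ₜ[ℚ] (((1 : ℚ), (1 : ℚ)) : ℚ × ℚ)) ((1 : ℂ) ⊗ₜ[ℚ] (((1 : ℚ), (1 : ℚ)) : ℚ × ℚ)) ≠ 0 := by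
    rw [hw]
    exact tmul_ne_zero_of_ne_zero one_ne_zero one_ne_zero
  obtain ⟨Γ', x, hx0, hxH, hxW⟩ := h F₀ hG h6 f₀ ι₁ hf V Γ _ _ h₀ h₁ hne
  -- translates of the (12)-wedge: only itself, so `x = lam ⊗ (1,1)`
  obtain ⟨lam, hlam⟩ := U.twistShadow_exists_eq_tmul_of_mem_span s Γ' 2 (((1 : ℚ), (1 : ℚ)) : ℚ × ℚ)
    (fun y hy => by
      obtain ⟨g, rfl⟩ := hy
      refine ⟨1, ?_⟩
      rw [U.twistShadow_pullC_pms s Γ' Γ g 2]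
      exact hw) hxH
  -- (34)-wedges: multiples of `1 ⊗ (1,0)`, so `x = mu ⊗ (1,0)`
  obtain ⟨mu, hmu⟩ := U.twistShadow_exists_eq_tmul_of_mem_span s Γ' 2 (((1 : ℚ), (0 : ℚ)) : ℚ × ℚ)
    (fun y hy => by
      obtain ⟨ω₂, ω₃, h₂, h₃, rfl⟩ := hy
      obtain ⟨c, rfl⟩ := U.twistShadow_exists_of_mem_Uiso s h₂
      obtain ⟨d, rfl⟩ := U.twistShadow_exists_of_mem_Uiso s h₃
      rw [hs2, hs3]
      refine ⟨c * d, ?_⟩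
      show LinearMap.BilinMap.baseChange ℂ (LinearMap.mul ℚ (ℚ × ℚ)) (c ⊗ₜ[ℚ] (((1 : ℚ), (0 : ℚ)) : ℚ × ℚ))
        (d ⊗ₜ[ℚ] (((1 : ℚ), (0 : ℚ)) : ℚ × ℚ)) = _
      rw [mulC_tmul_one, mul_zero]) hxW
  -- read the second coordinates of `lam ⊗ (1,1) = x = mu ⊗ (1,0)`: `lam = 0`
  have hT := congrArg
    (fun z => TensorProduct.AlgebraTensorModule.rid ℚ ℂ ℂ ((LinearMap.snd ℚ ℚ ℚ).baseChange ℂ z)) (hlam.symm.trans hmu)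
  simp only [rid_snd_baseChange_tmul, one_smul, zero_smul] at hT
  apply hx0
  rw [hlam, hT]
  exact TensorProduct.zero_tmul _ _

/-! ### Separation statements -/

/-- **`PeriodThmF ∧ FaceLineField ∧ FaceSupply ∧ FaceSeesawCoupling ∧ ¬ FaceWedgeOverlap` is satisfiable** relative to any
universe with M13 + M14 whose CM abelian varieties `A_{(K,Ψ)}` of distinct types are distinct: the twisted shadow whose
twist is the indicator of `{A_{Ψ₀}, A_{Ψ₁}}` for a face over `ℚ(ζ₇)`. [folklore] -/
theorem exists_faceSeesawCoupling_and_not_faceWedgeOverlap (hE : U.Fact_eigenLine) (hA : U.Fact_alphaLine)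
    (hinj : ∀ K : CMField, Function.Injective (U.cmAV K)) :
    ∃ U' : Universe, U'.PeriodThmF ∧ U'.FaceLineField ∧ U'.FaceSupply ∧ U'.FaceSeesawCoupling ∧ ¬ U'.FaceWedgeOverlap := by
  obtain ⟨F₀, hG, h6, f₀, ι₁, hf, V, -⟩ := periodThmF_binders_inhabited
  obtain ⟨h20, h21, h30, h31⟩ := Face.psi_ne f₀
  let s : U.Var → ℚ := Set.indicator {U.cmAV F₀ (f₀.psi 0), U.cmAV F₀ (f₀.psi 1)} (fun _ => (1 : ℚ))
  refine ⟨U.twistShadow s, U.twistShadow_periodThmF hE hA s, U.twistShadow_faceLineField hE hA s,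
    U.twistShadow_faceSupply hE hA s, U.twistShadow_faceSeesawCoupling hE hA s,
    U.twistShadow_not_faceWedgeOverlap hE hA s hG h6 f₀ hf V ?_ ?_ ?_ ?_⟩
  · exact Set.indicator_of_mem (Set.mem_insert _ _) _
  · exact Set.indicator_of_mem (Set.mem_insert_of_mem _ (Set.mem_singleton _)) _
  · refine Set.indicator_of_notMem ?_ _
    simp only [Set.mem_insert_iff, Set.mem_singleton_iff, not_or]
    exact ⟨(hinj F₀).ne h20, (hinj F₀).ne h21⟩
  · refine Set.indicator_of_notMem ?_ _
    simp only [Set.mem_insert_iff, Set.mem_singleton_iff, not_or]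
    exact ⟨(hinj F₀).ne h30, (hinj F₀).ne h31⟩

end Universe

/-! ### Unconditionally, through the CM-type universe -/

/-- Transporting a CM type along `e` and back along `e⁻¹` is the identity (local copy of
`Model.cmTypeMap_symm_cmTypeMap`, `CorCM/Model/CMProdBiproduct.lean`, to keep the import cone small). [folklore] -/
private theorem cmTypeMap_symm_cmTypeMap' {L E : Type} [Field L] [Field E] (e : L ≃+* E) (Φ : CMType L) :
    CMCode.cmTypeMap e.symm (CMCode.cmTypeMap e Φ) = Φ := by
  refine Subtype.ext (Set.ext fun σ => ?_)
  change (σ.comp e.symm.toRingHom).comp e.toRingHom ∈ Φ.1 ↔ σ ∈ Φ.1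
  have hσ : (σ.comp e.symm.toRingHom).comp e.toRingHom = σ := RingHom.ext fun x => by simp
  rw [hσ]

/-- **The cell's CM codes are injective in the type**: `Model.cmCode K Φ = Model.cmCode K Φ' → Φ = Φ'` (same code field
`(cmEmb K)(K)`, and the transported types agree). [folklore] -/
theorem Model.cmCode_injective (K : CMField) : Function.Injective (Model.cmCode K) := by
  intro Φ Φ' h
  have hΦ : HEq (Model.cmCode K Φ).Φ (Model.cmCode K Φ').Φ := by rw [h]
  have hΦ' : CMCode.cmTypeMap (Model.cmCodeEquiv K Φ) Φ = CMCode.cmTypeMap (Model.cmCodeEquiv K Φ) Φ' := eq_of_heq hΦ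
  have h' := congrArg (CMCode.cmTypeMap (Model.cmCodeEquiv K Φ).symm) hΦ'
  rwa [cmTypeMap_symm_cmTypeMap', cmTypeMap_symm_cmTypeMap'] at h'

/-- **`PeriodThmF ∧ FaceLineField ∧ FaceSupply ∧ FaceSeesawCoupling ∧ ¬ FaceWedgeOverlap` is satisfiable, unconditionally**:
the twisted shadow of the CM-type universe (M13 + M14 hold there and `cmAV K = Model.cmCode K` is injective). [folklore] -/
theorem exists_faceSeesawCoupling_not_faceWedgeOverlap :
    ∃ U : Universe, U.PeriodThmF ∧ U.FaceLineField ∧ U.FaceSupply ∧ U.FaceSeesawCoupling ∧ ¬ U.FaceWedgeOverlap :=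
  cmTypeUniverse.exists_faceSeesawCoupling_and_not_faceWedgeOverlap cmTypeUniverse_fact_eigenLine
    cmTypeUniverse_fact_alphaLine Model.cmCode_injective

/-- **B01-O is a genuine strengthening of the face-form period theorem**: `∀ U, U.PeriodThmF → U.FaceWedgeOverlap` is
FALSE. [folklore] -/
theorem not_forall_periodThmF_imp_faceWedgeOverlap : ¬ ∀ U : Universe, U.PeriodThmF → U.FaceWedgeOverlap := by
  intro h
  obtain ⟨U, hP, -, -, -, hO⟩ := exists_faceSeesawCoupling_not_faceWedgeOverlap
  exact hO (h U hP)

/-- The same with the interface spelling: `∀ U, U.PerLFace → U.FaceWedgeOverlap` is FALSE. [folklore] -/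
theorem not_forall_perLFace_imp_faceWedgeOverlap : ¬ ∀ U : Universe, U.PerLFace → U.FaceWedgeOverlap :=
  not_forall_periodThmF_imp_faceWedgeOverlap

/-- **B01-O is a genuine strengthening of B01-C** (even together with `PeriodThmF`, B01-L, B01-S):
`∀ U, U.PeriodThmF → U.FaceSeesawCoupling → U.FaceWedgeOverlap` is FALSE — over abstract universes the v3.22 leaf is
strictly stronger than the v3.21 leaf it replaced (the converse O → C needs the cone facts and Hodge–Riemann (2,0):
`Universe.faceSeesawCoupling_of_wedgeOverlap`). [folklore] -/
theorem not_forall_faceSeesawCoupling_imp_faceWedgeOverlap :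
    ¬ ∀ U : Universe, U.PeriodThmF → U.FaceSeesawCoupling → U.FaceWedgeOverlap := by
  intro h
  obtain ⟨U, hP, -, -, hC, hO⟩ := exists_faceSeesawCoupling_not_faceWedgeOverlap
  exact hO (h U hP hC)

end Summit.HodgeConjecture.CorCM

end
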